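import Literature.NumberTheory.IwasawaTheory.ImaginaryQuadraticTwoTowerRootsOfUnity
import Literature.NumberTheory.IwasawaTheory.ImaginaryQuadraticTwoTowerTotallyRamifiedEven
import HarnessLib

/-!
# No new roots of unity in the cyclotomic `ℤ₂`-tower of `ℚ(√−d)`, `d ≡ 1 (mod 4)` (hypothesis (W) of the no-capitulation files for the `2`-ramified half;
# proved; no definition, no named fact)

Topic `NumberTheory/IwasawaTheory` (namespace = path).  THEOREM-ONLY file, written by the prover seat `bsd-line-att-p3` g32 (cell `bsd-f1-sign2`; `--supports`
stmt-BirchSwinnertonDyer-22298; closes nothing).  The tree's `rootsOfUnity_mem_fieldRange` (seat g31, `ImaginaryQuadraticTwoTowerRootsOfUnity`) proves (W) — every root of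
unity of `X_m = e(K)·ℚ_m ⊆ ℚ̄` lies in `e(K)` — for `K ∋ √−d`, `d ≡ 3 (mod 4)`; its argument uses only that `d` is ODD and `≥ 3` (`i ∈ X_m` would put `√d ∈ X_m⁺`, a
primitive cube root would put `√(3d) ∈ X_m⁺`, both excluded at an odd prime `ℓ ∥ d`, `ℓ ∥ 3d` since `X_m⁺ ≅ ℚ_m` is unramified at odd primes; `φ(p^{k+1}) ≤ 2` kills
`p ≥ 5` and `9`).  This file records the same proof for `d ≡ 1 (mod 4)`, `d ≠ 1` (so `d ≥ 5`): ★ `rootsOfUnity_mem_fieldRange_of_mod_four_eq_one`, and the consequence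
`sq_ne_neg_one_of_sq_eq_neg_of_ne_one` (`−1 ∉ K²` for `K ∋ √−d`, `d ≠ 1` squarefree).

References: [Ferrero1980AJM] §3; [Washington1997] §13.1, Prop. 13.26; [NeukirchANT1999] Ch. III §2 Thm. (2.6).
-/

set_option autoImplicit false

noncomputable section

open scoped NumberField nonZeroDivisors
open NumberField NumberField.IsCMField IsDedekindDomain Field IntermediateField Module Ideal Finset

namespace Literature.NumberTheory.IwasawaTheory

open Literature.NumberTheory.EllipticCurves Literature.NumberTheory.EllipticCurves.ZpExtension
  Literature.NumberTheory.GaloisRepresentations Literature.NumberTheory.NumberFields Literature.NumberTheory.QuadraticFields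

/-! ## §1 `−1 ∉ K²` -/

section NegOne

variable (K : Type) [Field K] [NumberField K]

/-- **`−1` is not a square in `K = ℚ(√−d)`, `d ≠ 1` squarefree** (`[K : ℚ] = 2`, `K ∋ η`, `η² = −d`): `(a + bη)² = −1` forces `ab = 0`, then `a² = −1` or `d b² = 1`, and
the latter makes `d` a rational square, i.e. `d = 1`. [cite: Washington1997, §13.1] -/
theorem sq_ne_neg_one_of_sq_eq_neg_of_ne_one (hK2 : Module.finrank ℚ K = 2) {d : ℕ} (hsf : Squarefree d) (hd1 : d ≠ 1)
    (hη : ∃ η : K, η ^ 2 = -((d : ℕ) : K)) (k : K) : k ^ 2 ≠ -1 := by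
  classical
  obtain ⟨η, hη⟩ := hη
  have hd0 : 0 < d := Nat.pos_of_ne_zero fun h => by rw [h] at hsf; exact not_squarefree_zero hsf
  have hdpos : (0 : ℚ) < d := by exact_mod_cast hd0
  have hθ : η ∉ Set.range (algebraMap ℚ K) := by
    rintro ⟨q, hq⟩
    have h1 : algebraMap ℚ K (q ^ 2) = algebraMap ℚ K (-(d : ℚ)) := by
      rw [map_pow, hq, hη, map_neg, map_natCast]
    have h2 : q ^ 2 = -(d : ℚ) := (algebraMap ℚ K).injective h1
    nlinarith [sq_nonneg q]
  have hc : η ^ 2 = algebraMap ℚ K (-(d : ℚ)) := by rw [hη, map_neg, map_natCast]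
  intro hk
  obtain ⟨a, b, rfl⟩ := Quadratic.exists_eq_add_mul hK2 hθ k
  rw [pow_two, Quadratic.add_mul_mul_add_mul hc] at hk
  have hk' : algebraMap ℚ K (a * a + b * b * -(d : ℚ)) + algebraMap ℚ K (a * b + b * a) * η =
      algebraMap ℚ K (-1) + algebraMap ℚ K 0 * η := by rw [hk, map_neg, map_one, map_zero, zero_mul, add_zero]
  obtain ⟨h1, h2⟩ := Quadratic.ext_add_mul hθ hk'
  have hab : a * b = 0 := by linarith
  rcases mul_eq_zero.mp hab with ha | hb
  · rw [ha] at h1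
    have hsq : IsSquare (d : ℚ) := ⟨b⁻¹, by
      have hb0 : b ≠ 0 := by rintro rfl; norm_num at h1
      field_simp
      nlinarith [h1]⟩
    obtain ⟨r, hr⟩ := Rat.isSquare_natCast_iff.mp hsq
    have hr1 : IsUnit r := hsf r (by rw [hr])
    have : r = 1 := Nat.isUnit_iff.mp hr1
    apply hd1; rw [hr, this]
  · rw [hb] at h1
    have : a * a = -1 := by linarith
    nlinarith [mul_self_nonneg a]

end NegOne

/-! ## §2 (W) for `d ≡ 1 (mod 4)` -/

section RootsOfUnity

/-- For a prime `ℓ` dividing a squarefree number, `ℓ²` does not divide it. [folklore] -/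
private theorem not_sq_dvd_of_squarefree {d ℓ : ℕ} (hsf : Squarefree d) (hℓ : ℓ.Prime) : ¬ ℓ ^ 2 ∣ d := fun h =>
  hℓ.not_isUnit (hsf ℓ (by rw [← pow_two]; exact h))

variable {κ : ZpExtension ℚ 2} (hκ : κ.IsCyclotomic) (K : Type) [Field K] [NumberField K]

include hκ in
/-- ★ **(W) for `d ≡ 1 (mod 4)`: every root of unity of `X_m = e(K)·ℚ_m` lies in `e(K)`**, for `[K : ℚ] = 2`, `K ∋ η` with `η² = −d`, `d ≡ 1 (mod 4)` squarefree, `d ≠ 1` (verbatim the argument of the tree's `rootsOfUnity_mem_fieldRange`, `d ≡ 3 (mod 4)`; only `d` odd, `d ≥ 3` is used).  With `δ = e(η)`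
(`δ̄ = −δ`): a primitive `p`-th (`p ≥ 5`) or `9`-th root of unity is excluded by §3; `i ∈ X_m` would make `iδ ∈ X_m⁺` with square `d` (§1 at an `ℓ ∥ d`); a primitive cube
root `ζ` gives `w = 2ζ + 1`, `w² = −3`: if `d = 3` then `w = ±δ` and `ζ ∈ e(K)`, else `wδ ∈ X_m⁺` has square `3d` (§1 at an odd `ℓ ∥ 3d`).  So `x⁶ = 1`, `x³ = ±1`,
`x² ∈ {1, ζ₃^{±1}} ⊆ e(K)`, `x = x³/x² ∈ e(K)`. [cite: Ferrero1980AJM, §3] [cite: Washington1997, §13.1 and Prop. 13.26] -/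
theorem rootsOfUnity_mem_fieldRange_of_mod_four_eq_one (hK2 : Module.finrank ℚ K = 2) {d : ℕ} (hsf : Squarefree d) (hd4 : d % 4 = 1) (hd1 : d ≠ 1)
    (hη : ∃ η : K, η ^ 2 = -((d : ℕ) : K)) (m : ℕ) (x : ↥((absEmbedding ℚ K).fieldRange ⊔ κ.layer m))
    (hx : ∃ k : ℕ, 0 < k ∧ x ^ k = 1) : (x : AlgebraicClosure ℚ) ∈ (absEmbedding ℚ K).fieldRange := by
  classical
  have hIQ := isImaginaryQuadratic_of_sq_eq_neg K hK2 (by omega) hη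
  haveI : NumberField ↥((absEmbedding ℚ K).fieldRange ⊔ κ.layer m) := numberField_fieldRange_sup_layer κ K (absEmbedding ℚ K) m
  obtain ⟨hCM, -, hrest⟩ := isCMField_fieldRange_sup_layer hκ K hIQ (absEmbedding ℚ K) m
  haveI : IsCMField ↥((absEmbedding ℚ K).fieldRange ⊔ κ.layer m) := hCM
  obtain ⟨-, -, hdisc0, -⟩ := hrest
  have hdisc : ∀ ℓ : ℕ, ℓ.Prime → ℓ ≠ 2 → ¬ (ℓ : ℤ) ∣ NumberField.discr ↥(maximalRealSubfield ↥((absEmbedding ℚ K).fieldRange ⊔ κ.layer m)) := hdisc0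
  obtain ⟨η, hη⟩ := hη
  have hd3 : 3 ≤ d := by
    rcases Nat.lt_or_ge d 3 with h | h
    · exfalso; interval_cases d <;> omega
    · exact h
  have hd0 : (0 : ℚ) < d := by exact_mod_cast (show 0 < d by omega)
  let eK : K →+* ↥((absEmbedding ℚ K).fieldRange ⊔ κ.layer m) := ((absEmbedding ℚ K) : K →+* AlgebraicClosure ℚ).codRestrict ((absEmbedding ℚ K).fieldRange ⊔ κ.layer m) fun y =>
    (le_sup_left : (absEmbedding ℚ K).fieldRange ≤ (absEmbedding ℚ K).fieldRange ⊔ κ.layer m) ((absEmbedding ℚ K).mem_fieldRange.mpr ⟨y, rfl⟩)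
  set δ : ↥((absEmbedding ℚ K).fieldRange ⊔ κ.layer m) := eK η with hδdef
  have hδmem : ∀ y : K, ((eK y : ↥((absEmbedding ℚ K).fieldRange ⊔ κ.layer m)) : AlgebraicClosure ℚ) ∈ (absEmbedding ℚ K).fieldRange := fun y =>
    (absEmbedding ℚ K).mem_fieldRange.mpr ⟨y, rfl⟩
  have hδ2 : δ ^ 2 = -((d : ℚ) : ↥((absEmbedding ℚ K).fieldRange ⊔ κ.layer m)) := by
    rw [hδdef, ← map_pow, hη, map_neg, map_natCast, Rat.cast_natCast]
  have hδconj : complexConj ↥((absEmbedding ℚ K).fieldRange ⊔ κ.layer m) δ = -δ := complexConj_eq_neg_of_sq_eq_neg ↥((absEmbedding ℚ K).fieldRange ⊔ κ.layer m) hd0 hδ2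
  have hδ0 : δ ≠ 0 := by
    intro h0; rw [h0, zero_pow two_ne_zero] at hδ2
    have h1 : ((d : ℚ) : ↥((absEmbedding ℚ K).fieldRange ⊔ κ.layer m)) = 0 := by linear_combination hδ2
    have h2 : d = 0 := by exact_mod_cast h1
    omega
  -- membership of `e(K)` in terms of `eK`
  have hmemK : ∀ z : ↥((absEmbedding ℚ K).fieldRange ⊔ κ.layer m), (∃ y : K, eK y = z) → (z : AlgebraicClosure ℚ) ∈ (absEmbedding ℚ K).fieldRange := by
    rintro z ⟨y, rfl⟩; exact hδmem y
  -- (I) `i ∉ X`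
  have hI : ∀ y : ↥((absEmbedding ℚ K).fieldRange ⊔ κ.layer m), y ^ 2 = -1 → False := by
    intro y hy
    have hyconj : complexConj ↥((absEmbedding ℚ K).fieldRange ⊔ κ.layer m) y = -y := complexConj_eq_neg_of_sq_eq_neg ↥((absEmbedding ℚ K).fieldRange ⊔ κ.layer m) one_pos (by rw [hy]; norm_num)
    have hreal : complexConj ↥((absEmbedding ℚ K).fieldRange ⊔ κ.layer m) (y * δ) = y * δ := by rw [map_mul, hyconj, hδconj]; ring
    have ht : (y * δ) ^ 2 = (d : ↥((absEmbedding ℚ K).fieldRange ⊔ κ.layer m)) := by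
      rw [mul_pow, hy, hδ2, Rat.cast_natCast]; ring
    obtain ⟨ℓ, hℓ, hℓd⟩ := Nat.exists_prime_and_dvd (show d ≠ 1 by omega)
    have hℓ2 : ℓ ≠ 2 := by rintro rfl; omega
    exact false_of_real_sq_eq _ hdisc hreal ht hℓ hℓ2 hℓd (not_sq_dvd_of_squarefree hsf hℓ)
  -- (C3) primitive cube roots lie in `e(K)`
  have hC3 : ∀ ζ : ↥((absEmbedding ℚ K).fieldRange ⊔ κ.layer m), ζ ^ 2 + ζ + 1 = 0 → (ζ : AlgebraicClosure ℚ) ∈ (absEmbedding ℚ K).fieldRange := by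
    intro ζ hζ
    set w : ↥((absEmbedding ℚ K).fieldRange ⊔ κ.layer m) := 2 * ζ + 1 with hw
    have hw2 : w ^ 2 = -((3 : ℚ) : ↥((absEmbedding ℚ K).fieldRange ⊔ κ.layer m)) := by
      rw [hw]; push_cast; linear_combination 4 * hζ
    have hwconj : complexConj ↥((absEmbedding ℚ K).fieldRange ⊔ κ.layer m) w = -w := complexConj_eq_neg_of_sq_eq_neg ↥((absEmbedding ℚ K).fieldRange ⊔ κ.layer m) (by norm_num) hw2
    by_cases hd3' : d = 3
    · -- `w = ±δ`, so `ζ = (±δ − 1)/2 ∈ e(K)`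
      subst hd3'
      have hprod : (w - δ) * (w + δ) = 0 := by
        have : w ^ 2 = δ ^ 2 := by rw [hw2, hδ2]; norm_num
        linear_combination this
      have h2 : (2 : ↥((absEmbedding ℚ K).fieldRange ⊔ κ.layer m)) ≠ 0 := two_ne_zero
      rcases mul_eq_zero.mp hprod with h | h
      · apply hmemK
        refine ⟨(η - 1) / 2, ?_⟩
        rw [map_div₀, map_sub, map_one, map_ofNat]
        change (δ - 1) / 2 = ζ
        rw [← sub_eq_zero.mp h, hw]; ring
      · apply hmemK
        refine ⟨(-η - 1) / 2, ?_⟩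
        rw [map_div₀, map_sub, map_neg, map_one, map_ofNat]
        change (-δ - 1) / 2 = ζ
        have : δ = -w := by linear_combination h
        rw [this, hw]; ring
    · exfalso
      have hreal : complexConj ↥((absEmbedding ℚ K).fieldRange ⊔ κ.layer m) (w * δ) = w * δ := by rw [map_mul, hwconj, hδconj]; ring
      have ht : (w * δ) ^ 2 = ((3 * d : ℕ) : ↥((absEmbedding ℚ K).fieldRange ⊔ κ.layer m)) := by
        rw [mul_pow, hw2, hδ2]; push_cast; ring
      -- an odd prime `ℓ ∥ 3d`
      obtain ⟨ℓ, hℓ, hℓ2, hℓN, hℓ2N⟩ : ∃ ℓ : ℕ, ℓ.Prime ∧ ℓ ≠ 2 ∧ ℓ ∣ 3 * d ∧ ¬ ℓ ^ 2 ∣ 3 * d := by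
        by_cases h3 : 3 ∣ d
        · obtain ⟨d', rfl⟩ := h3
          have hd'1 : d' ≠ 1 := fun h => hd3' (by rw [h])
          obtain ⟨ℓ, hℓ, hℓd'⟩ := Nat.exists_prime_and_dvd hd'1
          have hℓ3 : ℓ ≠ 3 := by
            rintro rfl
            exact not_sq_dvd_of_squarefree hsf Nat.prime_three (by rw [pow_two]; exact Nat.mul_dvd_mul_left 3 hℓd')
          have hℓ2 : ℓ ≠ 2 := by
            rintro rfl
            have : 2 ∣ 3 * d' := dvd_mul_of_dvd_right hℓd' 3
            omega
          refine ⟨ℓ, hℓ, hℓ2, dvd_mul_of_dvd_right (dvd_mul_of_dvd_right hℓd' 3) 3, fun h => ?_⟩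
          -- `ℓ² ∣ 9 d'` with `ℓ ≠ 3` prime forces `ℓ² ∣ d'`
          have hcop : Nat.Coprime (ℓ ^ 2) 9 := by
            rw [show (9 : ℕ) = 3 ^ 2 by norm_num]
            exact Nat.Coprime.pow 2 2 ((Nat.coprime_primes hℓ Nat.prime_three).mpr hℓ3)
          have h' : ℓ ^ 2 ∣ 9 * d' := by rw [show 9 * d' = 3 * (3 * d') by ring]; exact h
          have := hcop.dvd_of_dvd_mul_left h'
          exact not_sq_dvd_of_squarefree (Squarefree.squarefree_of_dvd (dvd_mul_left d' 3) hsf) hℓ this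
        · refine ⟨3, Nat.prime_three, by norm_num, dvd_mul_right 3 d, fun h => h3 ?_⟩
          rw [pow_two] at h
          exact Nat.dvd_of_mul_dvd_mul_left (by norm_num) h
      exact false_of_real_sq_eq _ hdisc hreal ht hℓ hℓ2 hℓN hℓ2N
  -- the order of `x` divides `6`
  obtain ⟨k, hk, hxk⟩ := hx
  set n := orderOf x with hn
  have hn0 : 0 < n := by
    rw [hn, orderOf_pos_iff]; exact isOfFinOrder_iff_pow_eq_one.mpr ⟨k, hk, hxk⟩
  have hprim : IsPrimitiveRoot x n := IsPrimitiveRoot.orderOf x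
  have hn6 : n ∣ 6 := by
    refine (Nat.dvd_iff_prime_pow_dvd_dvd 6 n).mpr ?_
    intro p j hp hpj
    rcases j with _ | j
    · rw [pow_zero]; exact one_dvd _
    rcases Nat.lt_or_ge 3 p with hp3 | hp3
    · -- `p ≥ 5`: a primitive `p`-th root of unity, excluded
      exfalso
      have hpn : p ∣ n := (dvd_pow_self p (Nat.succ_ne_zero j)).trans hpj
      obtain ⟨c, hc⟩ := hpn
      have hζ : IsPrimitiveRoot (x ^ c) (p ^ (0 + 1)) := by
        rw [zero_add, pow_one]; exact hprim.pow hn0 (by rw [hc, mul_comm])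
      have hp2 : p ≠ 2 := by omega
      have := totient_le_two_of_isPrimitiveRoot _ hdisc hp hp2 hζ
      rw [pow_zero, one_mul] at this; omega
    · -- `p ∈ {2, 3}` and `p² ∤ n`
      have hp23 : p = 2 ∨ p = 3 := by
        have := hp.two_le; omega
      have hj : j = 0 := by
        by_contra hj0
        have hp2n : p ^ 2 ∣ n := (pow_dvd_pow p (show 2 ≤ j + 1 by omega)).trans hpj
        obtain ⟨c, hc⟩ := hp2n
        rcases hp23 with rfl | rfl
        · -- a primitive 4th root: its square is `−1`
          have hζ : IsPrimitiveRoot (x ^ c) 4 := hprim.pow hn0 (by rw [hc]; ring)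
          have h4 : (x ^ c) ^ 4 = 1 := hζ.pow_eq_one
          have h2 : (x ^ c) ^ 2 ≠ 1 := fun h => by
            have := hζ.dvd_of_pow_eq_one 2 h; omega
          have hsq : ((x ^ c) ^ 2) ^ 2 = 1 := by rw [← pow_mul]; exact h4
          rcases sq_eq_one_iff.mp hsq with h | h
          · exact h2 h
          · exact hI _ h
        · -- a primitive 9th root, excluded
          have hζ : IsPrimitiveRoot (x ^ c) (3 ^ (1 + 1)) := hprim.pow hn0 (by rw [hc]; ring)
          have := totient_le_two_of_isPrimitiveRoot _ hdisc Nat.prime_three (by norm_num) hζ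
          norm_num at this
      subst hj
      rcases hp23 with rfl | rfl <;> norm_num
  -- `x⁶ = 1`: `x³ = ±1`, `x²` is `1` or a primitive cube root, `x = x³ / x²`
  have hx6 : x ^ 6 = 1 := by
    obtain ⟨c, hc⟩ := hn6
    rw [hc, pow_mul, hn, pow_orderOf_eq_one, one_pow]
  have hx0 : x ≠ 0 := fun h => by rw [h, zero_pow (by norm_num)] at hx6; exact zero_ne_one hx6
  have h3 : x ^ 3 = 1 ∨ x ^ 3 = -1 := by
    have : (x ^ 3) ^ 2 = 1 := by rw [← pow_mul]; exact hx6
    exact sq_eq_one_iff.mp this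
  have h2mem : ((x ^ 2 : ↥((absEmbedding ℚ K).fieldRange ⊔ κ.layer m)) : AlgebraicClosure ℚ) ∈ (absEmbedding ℚ K).fieldRange := by
    have hcube : (x ^ 2) ^ 3 = 1 := by rw [← pow_mul]; exact hx6
    have hfac : (x ^ 2 - 1) * ((x ^ 2) ^ 2 + x ^ 2 + 1) = 0 := by linear_combination hcube
    rcases mul_eq_zero.mp hfac with h | h
    · rw [sub_eq_zero.mp h]; push_cast; exact one_mem _
    · exact hC3 _ h
  have h3mem : ((x ^ 3 : ↥((absEmbedding ℚ K).fieldRange ⊔ κ.layer m)) : AlgebraicClosure ℚ) ∈ (absEmbedding ℚ K).fieldRange := by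
    rcases h3 with h | h
    · rw [h]; push_cast; exact one_mem _
    · rw [h]; simp
  have hxeq : x = x ^ 3 / x ^ 2 := by field_simp
  rw [hxeq]
  push_cast
  exact div_mem h3mem h2mem

end RootsOfUnity

end Literature.NumberTheory.IwasawaTheory

end
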